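import Literature.NumberTheory.LFunctions.ConreyIwaniec2002Thm61ShiftedSmall
import Mathlib.Analysis.Normed.Group.Tannery
import HarnessLib

/-!
# Conrey–Iwaniec (2002), Theorem 6.1, (6.27): summing the pieces of `S*(h)` (limit over the partition)

B. Conrey, H. Iwaniec, Acta Arith. 103 (2002), §6 (6.27) [held text `paper:arxiv-math_0111012`,
p0015:L52–80]. The evaluation (6.27)
`S*(h) = σ(h)∫a(y+h)ā(y)L(hT/y)dy + O(Bτ(h)Y^{3/4}(log Y)⁴ + T⁻²h|σ(h)| + T⁻²h(log 3h)³)`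
is assembled from the pieces of the smooth `ρ`-adic partition of unity (`ρ = 9/8`,
`ConreyIwaniec2002Thm61Partition`): the partial sums `Σ_{k<N} η_k(m) = ψ_ρ(ρm/ρ^N) → 1`, so by
dominated convergence (Tannery's theorem for the sum (6.9), Lebesgue for the integral)
`S*(h) − σ(h)∫₀^∞ a(x+h)ā(x)L(hT/x)dx = lim_N Σ_{k<N} (S_k − σ(h)I_k)`; the pieces `k < k₀`
(`ρ^{k₀} ≤ 12h`) form the separated block (`ConreyIwaniec2002Thm61ShiftedSmall`), the pieces
`k ≥ k₀` are non-separated and (6.19) applies (`ConreyIwaniec2002Thm61ShiftedPieces`).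

Main result `norm_sub_total_le`: with `P = ρ²D(1+ρ⁸)`, `G₀ = ρ^{3/4}/(ρ^{3/4}−1) + (1−ρ^{−21/4})⁻¹`,
`|S*(h) − σ(h)∫₀^∞ a(x+h)ā(x)L(hT/x)dx| ≤ 121T⁻²·12h(1+log 12h)³ + |σ(h)|·121T⁻²·11h
   + 192P²G₀·Bτ(h)Y^{3/4}log²(3Y)`.

PROVED HERE (namespace `ConreyIwaniec2002.Thm61ShiftedLimit`), no `sorry`, no `def`; for the
registered stub S2b `stub_thm61_shifted` of SKELETON P64 (line `thm61-cm-convolution`).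

## References
* [ConreyIwaniec2002] B. Conrey, H. Iwaniec, Acta Arith. 103 (2002) 259–312: §6 (6.9), (6.14),
  (6.15), (6.19), (6.27).
-/

noncomputable section

open Set Filter MeasureTheory
open scoped Topology

namespace Literature.NumberTheory.LFunctions

namespace ConreyIwaniec2002

namespace Thm61ShiftedLimit

open Thm61Partition Thm61Bumps Thm61ShiftedArith Thm61ShiftedPieces

section Main

variable {ρ : ℝ} (hρ : ρ = 9 / 8) {K : ℝ → ℝ} (hK : IsCIKernel K)
  {lam : ℕ → ℂ} {σ : ℕ → ℝ} {B₁ : ℝ} (hB₁ : 0 ≤ B₁) (hS : ShiftedConvolutionBound lam σ B₁)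
  (hlam : ∀ n : ℕ, 1 ≤ n → ‖lam n‖ ≤ (Nat.divisors n).card)
  {T Y : ℝ} {a : ℝ → ℂ} (hT : 1 ≤ T) (hY : 2 ≤ Y) (ha : IsCutoff14 a Y) (ha0 : a 0 = 0)
  {h : ℕ} (hh : 1 ≤ h) {D : ℝ} (hD1 : 1 ≤ D)
  (hD : ∀ u v : ℝ, 0 < u → u ≤ v → ∀ m : ℕ, m ≤ 2 → ∀ x : ℝ,
      |x| ^ m * |iteratedDeriv m (plateau ρ u v) x| ≤ ρ ^ 2 * D * (1 + (v / u) ^ 2))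

/-! ### Absolute convergence of `S*(h)` -/

include ha in
/-- `‖a(y)‖ ≤ (1+y/Y)⁻⁴` on `y > 0`. [cite: ConreyIwaniec2002, §6 (6.14)] -/
theorem norm_a_le_weight {y : ℝ} (hy : 0 < y) : ‖a y‖ ≤ ((1 + y / Y) ^ 4)⁻¹ := by
  have h0 := ha.2 0 (by norm_num) y hy
  rwa [pow_zero, one_mul, iteratedDeriv_zero] at h0

include hK hlam hY ha ha0 hh in
/-- **`S*(h)` converges absolutely**: the summands are dominated by
`½(τ(n+h)²(1+(n+h)/Y)⁻⁸ + τ(n)²(1+n/Y)⁻⁸)`, summable by (6.17).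
[cite: ConreyIwaniec2002, §6 (6.9), (6.15)–(6.17)] -/
theorem summable_norm_term :
    Summable fun n : ℕ => ‖lam (n + h) * a ((n : ℝ) + h) * starRingEnd ℂ (lam n * a n) *
      (ciL K (h * T / n) : ℂ)‖ := by
  have hY0 : 0 < Y := by linarith
  obtain ⟨C, -, hC⟩ := Thm61DivisorMoments.divisorSq_moment_le (k := 0) (by norm_num)
  obtain ⟨hv, -⟩ := hC Y hY
  set v : ℕ → ℝ := fun n => (n : ℝ) ^ 0 * ((1 + (n : ℝ) / Y) ^ 8)⁻¹ * (n.divisors.card : ℝ) ^ 2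
    with hvdef
  have hv' : Summable fun n : ℕ => v (n + h) := (summable_nat_add_iff h).2 hv
  have hu : Summable fun n : ℕ => (v (n + h) + v n) / 2 := (hv'.add hv).div_const 2
  refine Summable.of_nonneg_of_le (fun _ => norm_nonneg _) (fun n => ?_) hu
  rcases Nat.eq_zero_or_pos n with rfl | hn
  · simp only [Nat.cast_zero, ha0, mul_zero, map_zero, zero_mul, norm_zero]
    have : 0 ≤ v (0 + h) := by simp only [hvdef]; positivity
    have : 0 ≤ v 0 := by simp only [hvdef]; positivity
    linarith
  have hn0 : (0:ℝ) < n := by exact_mod_cast hn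
  have hnh : (0:ℝ) < (n : ℝ) + h := by positivity
  -- the four factors
  have h1 : ‖lam (n + h)‖ ≤ (Nat.divisors (n + h)).card := hlam (n + h) (by omega)
  have h2 : ‖a ((n : ℝ) + h)‖ ≤ ((1 + ((n : ℝ) + h) / Y) ^ 4)⁻¹ := norm_a_le_weight ha hnh
  have h3 : ‖lam n‖ ≤ (Nat.divisors n).card := hlam n hn
  have h4 : ‖a n‖ ≤ ((1 + (n : ℝ) / Y) ^ 4)⁻¹ := norm_a_le_weight ha hn0
  have h5 : |ciL K (h * T / n)| ≤ 1 := Thm61OffDiagSeries.abs_ciL_le_one hK _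
  set x : ℝ := ((Nat.divisors (n + h)).card : ℝ) * ((1 + ((n : ℝ) + h) / Y) ^ 4)⁻¹ with hx
  set y : ℝ := ((Nat.divisors n).card : ℝ) * ((1 + (n : ℝ) / Y) ^ 4)⁻¹ with hy
  have hxy : x * y ≤ (x ^ 2 + y ^ 2) / 2 := by nlinarith [sq_nonneg (x - y)]
  have ex : x ^ 2 = v (n + h) := by
    simp only [hx, hvdef, pow_zero, one_mul, Nat.cast_add]
    rw [mul_pow, inv_pow, ← pow_mul]; ring
  have ey : y ^ 2 = v n := by
    simp only [hy, hvdef, pow_zero, one_mul]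
    rw [mul_pow, inv_pow, ← pow_mul]; ring
  calc ‖lam (n + h) * a ((n : ℝ) + h) * starRingEnd ℂ (lam n * a n) * (ciL K (h * T / n) : ℂ)‖
      = ‖lam (n + h)‖ * ‖a ((n : ℝ) + h)‖ * (‖lam n‖ * ‖a n‖) * |ciL K (h * T / n)| := by
        rw [norm_mul, norm_mul, norm_mul, Complex.norm_conj, norm_mul, Complex.norm_real,
          Real.norm_eq_abs]
    _ ≤ (Nat.divisors (n + h)).card * ((1 + ((n : ℝ) + h) / Y) ^ 4)⁻¹ *
          ((Nat.divisors n).card * ((1 + (n : ℝ) / Y) ^ 4)⁻¹) * 1 := by gcongr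
    _ = x * y := by rw [hx, hy, mul_one]
    _ ≤ (v (n + h) + v n) / 2 := by rw [← ex, ← ey]; exact hxy

/-! ### The partial sums over the partition -/

include hρ hK hlam hY ha ha0 hh in
/-- Each piece of `S*(h)` converges absolutely (`|η_k| ≤ 1`). [cite: ConreyIwaniec2002, §6 (6.27)] -/
theorem summable_piece (k : ℕ) :
    Summable fun n : ℕ => lam (n + h) * a ((n : ℝ) + h) * starRingEnd ℂ (lam n * a n) *
      (ciL K (h * T / n) : ℂ) * (plateau ρ (ρ ^ k / ρ) (ρ ^ k) ((n : ℝ) + h) : ℂ) := by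
  obtain ⟨hρ1, hρ0, -, -, -⟩ := rho_facts hρ
  have hu : 0 < ρ ^ k / ρ := by positivity
  have huv : ρ ^ k / ρ ≤ ρ ^ k := div_le_self (pow_pos hρ0 k).le hρ1.le
  refine Summable.of_norm_bounded (summable_norm_term hK hlam hY ha ha0 hh (T := T)) fun n => ?_
  rw [norm_mul, Complex.norm_real, Real.norm_eq_abs]
  exact mul_le_of_le_one_right (norm_nonneg _) (abs_plateau_le_one hρ1 hu huv _)

include hρ hK hlam hY ha ha0 hh in
/-- `Σ_n F(n)·Σ_{k<N}η_k(n+h) = Σ_{k<N} S_k`. [cite: ConreyIwaniec2002, §6 (6.27)] -/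
theorem tsum_block_eq (N : ℕ) :
    (∑' n : ℕ, lam (n + h) * a ((n : ℝ) + h) * starRingEnd ℂ (lam n * a n) *
        (ciL K (h * T / n) : ℂ) *
        ((∑ k ∈ Finset.range N, plateau ρ (ρ ^ k / ρ) (ρ ^ k) ((n : ℝ) + h) : ℝ) : ℂ)) =
      ∑ k ∈ Finset.range N, ∑' n : ℕ, lam (n + h) * a ((n : ℝ) + h) *
        starRingEnd ℂ (lam n * a n) * (ciL K (h * T / n) : ℂ) *
        (plateau ρ (ρ ^ k / ρ) (ρ ^ k) ((n : ℝ) + h) : ℂ) := by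
  rw [← Summable.tsum_finsetSum (fun k _ => summable_piece hρ hK hlam hY ha ha0 hh k)]
  refine tsum_congr fun n => ?_
  rw [Complex.ofReal_sum, Finset.mul_sum]

include hρ hK hlam hY ha ha0 hh in
/-- **Tannery**: `Σ_n F(n)·Σ_{k<N}η_k(n+h) → S*(h)` as `N → ∞`. [cite: ConreyIwaniec2002, §6 (6.27)] -/
theorem tendsto_tsum_block :
    Tendsto (fun N : ℕ => ∑' n : ℕ, lam (n + h) * a ((n : ℝ) + h) * starRingEnd ℂ (lam n * a n) *
        (ciL K (h * T / n) : ℂ) *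
        ((∑ k ∈ Finset.range N, plateau ρ (ρ ^ k / ρ) (ρ ^ k) ((n : ℝ) + h) : ℝ) : ℂ))
      atTop (𝓝 (∑' n : ℕ, lam (n + h) * a ((n : ℝ) + h) * starRingEnd ℂ (lam n * a n) *
        (ciL K (h * T / n) : ℂ))) := by
  obtain ⟨hρ1, -, -, -, -⟩ := rho_facts hρ
  have hh1 : (1:ℝ) ≤ h := by exact_mod_cast hh
  refine tendsto_tsum_of_dominated_convergence
    (summable_norm_term hK hlam hY ha ha0 hh (T := T)) (fun n => ?_)
    (Eventually.of_forall fun N n => ?_)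
  · have h1 : (1:ℝ) ≤ (n : ℝ) + h := by have := (Nat.cast_nonneg n : (0:ℝ) ≤ n); linarith
    have ht := tendsto_sum_range_plateau hρ1 h1
    have hc : Tendsto (fun N : ℕ => ((∑ k ∈ Finset.range N,
        plateau ρ (ρ ^ k / ρ) (ρ ^ k) ((n : ℝ) + h) : ℝ) : ℂ)) atTop (𝓝 ((1 : ℝ) : ℂ)) :=
      (Complex.continuous_ofReal.tendsto 1).comp ht
    have := hc.const_mul (lam (n + h) * a ((n : ℝ) + h) * starRingEnd ℂ (lam n * a n) *
        (ciL K (h * T / n) : ℂ))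
    simpa using this
  · rw [norm_mul, Complex.norm_real, Real.norm_eq_abs]
    exact mul_le_of_le_one_right (norm_nonneg _) (block_weight hρ hh (Nat.cast_nonneg n)).1

/-! ### The integral side -/

include hK ha in
/-- The integrand `G(x) = a(x+h)ā(x)L(hT/x)` is continuous on `(0,∞)`.
[cite: ConreyIwaniec2002, §6 (6.27)] -/
theorem continuousOn_G :
    ContinuousOn (fun x : ℝ => a (x + h) * starRingEnd ℂ (a x) * (ciL K (h * T / x) : ℂ))
      (Ioi 0) := by
  have hac : ContinuousOn a (Ioi 0) := ha.1.continuousOn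
  have h0 : (0:ℝ) ≤ h := Nat.cast_nonneg h
  refine ContinuousOn.mul (ContinuousOn.mul ?_ ?_) ?_
  · exact hac.comp (continuousOn_id.add continuousOn_const) fun x hx => by
      simp only [mem_Ioi] at hx ⊢; linarith
  · exact (Complex.continuous_conj.comp_continuousOn hac)
  · refine Complex.continuous_ofReal.comp_continuousOn
      ((Thm61OffDiagSeries.continuous_ciL hK).comp_continuousOn ?_)
    exact continuousOn_const.div continuousOn_id fun x hx => ne_of_gt hx

include hK hY ha in
/-- `‖G(x)‖ ≤ (1+x/Y)⁻⁸` on `x > 0`, and `G` is integrable on `(0,∞)`.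
[cite: ConreyIwaniec2002, §6 (6.14), (6.27)] -/
theorem integrable_G :
    (∀ x : ℝ, 0 < x → ‖a (x + h) * starRingEnd ℂ (a x) * (ciL K (h * T / x) : ℂ)‖ ≤
        ((1 + x / Y) ^ 4)⁻¹ * ((1 + x / Y) ^ 4)⁻¹) ∧
      IntegrableOn (fun x : ℝ => a (x + h) * starRingEnd ℂ (a x) * (ciL K (h * T / x) : ℂ))
        (Ioi 0) := by
  have hY0 : 0 < Y := by linarith
  have h0 : (0:ℝ) ≤ h := Nat.cast_nonneg h
  have hbd : ∀ x : ℝ, 0 < x → ‖a (x + h) * starRingEnd ℂ (a x) * (ciL K (h * T / x) : ℂ)‖ ≤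
      ((1 + x / Y) ^ 4)⁻¹ * ((1 + x / Y) ^ 4)⁻¹ := by
    intro x hx
    rw [norm_mul, norm_mul, Complex.norm_conj, Complex.norm_real, Real.norm_eq_abs]
    have h1 : ‖a (x + h)‖ ≤ ((1 + x / Y) ^ 4)⁻¹ := by
      refine (norm_a_le_weight ha (by linarith)).trans (inv_anti₀ (by positivity) ?_)
      apply pow_le_pow_left₀ (by positivity)
      have : x / Y ≤ (x + h) / Y := div_le_div_of_nonneg_right (by linarith) hY0.le
      linarith
    have h2 := norm_a_le_weight ha hx
    have h3 := Thm61OffDiagSeries.abs_ciL_le_one hK (h * T / x)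
    calc ‖a (x + h)‖ * ‖a x‖ * |ciL K (h * T / x)| ≤
        ((1 + x / Y) ^ 4)⁻¹ * ((1 + x / Y) ^ 4)⁻¹ * 1 := by gcongr
      _ = _ := mul_one _
  refine ⟨hbd, ?_⟩
  -- majorant `y^{1-1}‖g‖²` with `g = (1+y/Y)⁻⁴`
  set g : ℝ → ℂ := fun y => ((((1 + y / Y) ^ 4)⁻¹ : ℝ) : ℂ) with hg
  have hgb : ∀ y : ℝ, 0 < y → ‖g y‖ ≤ ((1 + y / Y) ^ 4)⁻¹ := fun y hy => by
    rw [hg, Complex.norm_real, Real.norm_of_nonneg (by positivity)]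
  have hgc : ContinuousOn g (Ioi 0) := by
    refine Complex.continuous_ofReal.comp_continuousOn (ContinuousOn.inv₀ (by fun_prop) ?_)
    intro y hy; have : (0:ℝ) < y := hy; positivity
  obtain ⟨hint, -⟩ := Thm61OffDiagSeries.integral_rpow_mul_normSq_g_le hY hgb hgc
    (c := 1) le_rfl (by norm_num)
  have hgn : ∀ y : ℝ, 0 < y → ‖g y‖ = ((1 + y / Y) ^ 4)⁻¹ := fun y hy => by
    rw [hg, Complex.norm_real, Real.norm_of_nonneg (by positivity)]
  refine Integrable.mono' hint
    ((continuousOn_G hK ha (T := T) (h := h)).aestronglyMeasurable measurableSet_Ioi) ?_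
  refine (ae_restrict_iff' measurableSet_Ioi).2 (Eventually.of_forall fun x hx => ?_)
  refine (hbd x hx).trans (le_of_eq ?_)
  rw [hgn x hx, sub_self, Real.rpow_zero, one_mul, sq]

include hK hY ha in
/-- Each piece of the integral is integrable on `(0,∞)` (`|η_k| ≤ 1`, continuity).
[cite: ConreyIwaniec2002, §6 (6.27)] -/
theorem integrable_piece (w : ℝ → ℝ) (hwc : Continuous w) (hw1 : ∀ x, |w x| ≤ 1) :
    IntegrableOn (fun x : ℝ => a (x + h) * starRingEnd ℂ (a x) * (ciL K (h * T / x) : ℂ) *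
      (w (x + h) : ℂ)) (Ioi 0) := by
  obtain ⟨-, hG⟩ := integrable_G hK hY ha (T := T) (h := h)
  refine Integrable.mono' hG.norm ?_ ?_
  · exact ((continuousOn_G hK ha (T := T) (h := h)).mul ((Complex.continuous_ofReal.comp
      (hwc.comp (continuous_id.add continuous_const))).continuousOn)).aestronglyMeasurable
      measurableSet_Ioi
  · refine Eventually.of_forall fun x => ?_
    rw [norm_mul, Complex.norm_real, Real.norm_eq_abs]
    exact mul_le_of_le_one_right (norm_nonneg _) (hw1 _)

include hρ hK hY ha in
/-- `∫₀^∞ G·Σ_{k<N}η_k(x+h) = Σ_{k<N} I_k`. [cite: ConreyIwaniec2002, §6 (6.27)] -/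
theorem integral_block_eq (N : ℕ) :
    (∫ x in Ioi (0:ℝ), a (x + h) * starRingEnd ℂ (a x) * (ciL K (h * T / x) : ℂ) *
        ((∑ k ∈ Finset.range N, plateau ρ (ρ ^ k / ρ) (ρ ^ k) (x + h) : ℝ) : ℂ)) =
      ∑ k ∈ Finset.range N, ∫ x in Ioi (0:ℝ), a (x + h) * starRingEnd ℂ (a x) *
        (ciL K (h * T / x) : ℂ) * (plateau ρ (ρ ^ k / ρ) (ρ ^ k) (x + h) : ℂ) := by
  obtain ⟨hρ1, hρ0, -, -, -⟩ := rho_facts hρ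
  rw [← integral_finsetSum _ (fun k _ => integrable_piece hK hY ha (h := h) _ (plateau_continuous ρ _ _)
    (fun x => abs_plateau_le_one hρ1 (by positivity)
      (div_le_self (pow_pos hρ0 k).le hρ1.le) x))]
  refine setIntegral_congr_fun measurableSet_Ioi fun x _ => ?_
  rw [Complex.ofReal_sum, Finset.mul_sum]

include hρ hK hY ha hh in
/-- **Dominated convergence**: `∫₀^∞ G·Σ_{k<N}η_k(x+h) → ∫₀^∞ G`.
[cite: ConreyIwaniec2002, §6 (6.27)] -/
theorem tendsto_integral_block :
    Tendsto (fun N : ℕ => ∫ x in Ioi (0:ℝ), a (x + h) * starRingEnd ℂ (a x) *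
        (ciL K (h * T / x) : ℂ) *
        ((∑ k ∈ Finset.range N, plateau ρ (ρ ^ k / ρ) (ρ ^ k) (x + h) : ℝ) : ℂ))
      atTop (𝓝 (∫ x in Ioi (0:ℝ), a (x + h) * starRingEnd ℂ (a x) * (ciL K (h * T / x) : ℂ))) := by
  obtain ⟨hρ1, hρ0, -, -, -⟩ := rho_facts hρ
  have hh1 : (1:ℝ) ≤ h := by exact_mod_cast hh
  obtain ⟨-, hG⟩ := integrable_G hK hY ha (T := T) (h := h)
  refine tendsto_integral_of_dominated_convergence
    (fun x => ‖a (x + h) * starRingEnd ℂ (a x) * (ciL K (h * T / x) : ℂ)‖)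
    (fun N => ?_) hG.norm (fun N => ?_) ?_
  · exact ((continuousOn_G hK ha (T := T) (h := h)).mul ((Complex.continuous_ofReal.comp
      ((continuous_finsetSum _ fun k _ => plateau_continuous ρ _ _).comp
        (continuous_id.add continuous_const))).continuousOn)).aestronglyMeasurable
      measurableSet_Ioi
  · refine (ae_restrict_iff' measurableSet_Ioi).2 (Eventually.of_forall fun x hx => ?_)
    rw [norm_mul, Complex.norm_real, Real.norm_eq_abs]
    exact mul_le_of_le_one_right (norm_nonneg _) (block_weight hρ hh (le_of_lt hx)).1
  · refine (ae_restrict_iff' measurableSet_Ioi).2 (Eventually.of_forall fun x hx => ?_)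
    have h1 : (1:ℝ) ≤ x + h := by have : (0:ℝ) < x := hx; linarith
    have hc : Tendsto (fun N : ℕ => ((∑ k ∈ Finset.range N,
        plateau ρ (ρ ^ k / ρ) (ρ ^ k) (x + h) : ℝ) : ℂ)) atTop (𝓝 ((1 : ℝ) : ℂ)) :=
      (Complex.continuous_ofReal.tendsto 1).comp (tendsto_sum_range_plateau hρ1 h1)
    have := hc.const_mul (a (x + h) * starRingEnd ℂ (a x) * (ciL K (h * T / x) : ℂ))
    simpa using this

/-! ### The estimate (6.27) with the main term `σ(h)∫₀^∞ a(x+h)ā(x)L(hT/x)dx` -/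

include hρ hK hB₁ hS hlam hT hY ha ha0 hh hD1 hD in
/-- **(6.27)**: `|S*(h) − σ(h)∫₀^∞ a(x+h)ā(x)L(hT/x)dx| ≤ 121T⁻²·12h(1+log 12h)³ + |σ(h)|·121T⁻²·11h
+ 192P²G₀·Bτ(h)Y^{3/4}log²(3Y)`. [cite: ConreyIwaniec2002, §6 (6.27)] -/
theorem norm_sub_total_le :
    ‖(∑' n : ℕ, lam (n + h) * a ((n : ℝ) + h) * starRingEnd ℂ (lam n * a n) *
          (ciL K (h * T / n) : ℂ)) -
        (σ h : ℂ) * ∫ x in Ioi (0:ℝ), a (x + h) * starRingEnd ℂ (a x) * (ciL K (h * T / x) : ℂ)‖ ≤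
      121 / T ^ 2 * (12 * h * (1 + Real.log (12 * h)) ^ 3) + |σ h| * (121 / T ^ 2 * (11 * h)) +
        192 * (ρ ^ 2 * D * (1 + ρ ^ 8)) ^ 2 * B₁ * (Nat.divisors h).card *
          ((ρ ^ (3 / 4 : ℝ) / (ρ ^ (3 / 4 : ℝ) - 1) + (1 - ρ ^ (-(21 / 4) : ℝ))⁻¹) *
            Y ^ (3 / 4 : ℝ) * Real.log (3 * Y) ^ 2) := by
  obtain ⟨hρ1, hρ0, -, -, -⟩ := rho_facts hρ
  have hh0 : (0:ℝ) < h := by exact_mod_cast hh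
  -- the threshold `k₀`
  have hex : ∃ k : ℕ, 81 * (h : ℝ) ≤ 8 * ρ ^ k := by
    obtain ⟨k, hk⟩ := ((tendsto_pow_atTop_atTop_of_one_lt hρ1).eventually_ge_atTop
      (81 * (h : ℝ) / 8)).exists
    exact ⟨k, by linarith⟩
  classical
  set k₀ := Nat.find hex with hk₀
  have hlarge : ∀ k : ℕ, k₀ ≤ k → (h : ℝ) ≤ ρ ^ k / ρ - ρ ^ k / ρ ^ 2 := by
    intro k hk
    have h1 : 81 * (h : ℝ) ≤ 8 * ρ ^ k₀ := Nat.find_spec hex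
    have h2 : ρ ^ k₀ ≤ ρ ^ k := pow_le_pow_right₀ hρ1.le hk
    have e : ρ ^ k / ρ - ρ ^ k / ρ ^ 2 = ρ ^ k * (8 / 81) := by
      rw [div_eq_mul_inv, div_eq_mul_inv, ← mul_sub]; congr 1; rw [hρ]; norm_num
    rw [e]; linarith
  have hh1 : (1:ℝ) ≤ h := by exact_mod_cast hh
  have hsmall : ρ ^ k₀ ≤ 12 * h := by
    rcases Nat.eq_zero_or_pos k₀ with h0 | hpos
    · rw [h0, pow_zero]; linarith
    · have hm : ¬ 81 * (h : ℝ) ≤ 8 * ρ ^ (k₀ - 1) := Nat.find_min hex (by omega)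
      have hm' : 8 * ρ ^ (k₀ - 1) < 81 * h := not_le.1 hm
      have e : ρ ^ k₀ = ρ * ρ ^ (k₀ - 1) := by rw [← pow_succ']; congr 1; omega
      have e' : ρ * ρ ^ (k₀ - 1) = 9 / 8 * ρ ^ (k₀ - 1) := by rw [hρ]
      rw [e, e']
      linarith
  -- the limit
  have hP := tendsto_tsum_block hρ hK hlam hY ha ha0 hh (T := T)
  have hQ := tendsto_integral_block hρ hK hY ha hh (T := T)
  have hlim := (hP.sub (hQ.const_mul (σ h : ℂ))).norm
  refine le_of_tendsto hlim ?_
  filter_upwards [eventually_ge_atTop k₀] with N hN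
  -- split the block sum at `k₀`
  rw [tsum_block_eq hρ hK hlam hY ha ha0 hh, integral_block_eq hρ hK hY ha (h := h), Finset.mul_sum,
    ← Finset.sum_sub_distrib, ← Finset.sum_range_add_sum_Ico _ hN]
  refine (norm_add_le _ _).trans (add_le_add ?_ ?_)
  · -- separated block: `k < k₀`
    rw [Finset.sum_sub_distrib, ← Finset.mul_sum, ← tsum_block_eq hρ hK hlam hY ha ha0 hh,
      ← integral_block_eq hρ hK hY ha (h := h)]
    refine (norm_sub_le _ _).trans (add_le_add (small_block_sum_bound hρ hK hlam hT hY ha ha0 hh hsmall) ?_)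
    rw [norm_mul, Complex.norm_real, Real.norm_eq_abs]
    exact mul_le_mul_of_nonneg_left (small_block_integral_bound hρ hK hT hY ha hh hsmall)
      (abs_nonneg _)
  · -- non-separated pieces: `k₀ ≤ k < N`
    refine (norm_sum_le _ _).trans ?_
    exact large_block_bound hρ hK hB₁ hS hT hY ha ha0 hh hD1 hD _
      (fun k hk => hlarge k (Finset.mem_Ico.1 hk).1)

end Main

end Thm61ShiftedLimit

end ConreyIwaniec2002

end Literature.NumberTheory.LFunctions

end
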